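import Summits.MatrixMultiplication.MatrixMultiplication.Theorems.SoloInformedCwTwoDemotion
import Summits.MatrixMultiplication.MatrixMultiplication.Theorems.SoloInformedCwTwoLevelOrient

/-!
# HALF-ORIENT by induction on the number of pairs: reduction to last-rigid systems (solo-informed, gen 13; c161)

By the demotion lemma (`orientedHallSix_of_demote`) the working orientations of the system with the last pair
demoted lift, doubled, into the working orientations of the full system:
`2 · W(demoted) ≤ W(full)` (`two_mul_workingOrientations_demote_le`).  Hence HALF-ORIENT (`2^p ≤ 2 · W`)
propagates from the demoted system whenever the latter is a mixed design, and the conjecture REDUCES to the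
systems whose last-pair demotion is NOT a mixed design (`halfOrientConjecture_of_rigidStep`); the base case
`p = 0` is unconditional (`zeroPair_hallSix`).  With pair reindexing (`SoloInformedCwTwoReindex`) "last pair"
becomes "some pair", i.e. the residual class is the RIGID systems of the solo-informed paper §2h(17)(c).

Standard axioms only.
-/

namespace Summit.MatrixMultiplication.MatrixMultiplication.Theorems

open Finset

/-- Appending the orientation of the last pair is injective on (orientation of the first `p` pairs, last bit). -/
lemma snoc_orient_injective (p : ℕ) :
    Function.Injective (fun ob : (Fin p → Bool) × Bool => (Fin.snoc ob.1 ob.2 : Fin (p + 1) → Bool)) := by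
  rintro ⟨o₁, b₁⟩ ⟨o₂, b₂⟩ h
  have hl := congrFun h (Fin.last p)
  simp only [Fin.snoc_last] at hl
  have hc : o₁ = o₂ := by
    funext i
    have := congrFun h i.castSucc
    simpa using this
  simp [hc, hl]

/-- **Lifting count.** Twice the number of working orientations of the demoted system is at most the number of
working orientations of the full system. -/
theorem two_mul_workingOrientations_demote_le {p q : ℕ} (s d : Fin (p + 1) → ℕ) (t : Fin q → ℕ) :
    2 * workingOrientations (fun i : Fin p => s i.castSucc) (fun i => d i.castSucc) (demoteT s d t) ≤
      workingOrientations s d t := by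
  classical
  unfold workingOrientations
  set A := (Finset.univ.filter fun o : Fin p → Bool =>
    OrientedHallSix (fun i : Fin p => s i.castSucc) (fun i => d i.castSucc) (demoteT s d t) o) with hA
  set B := (Finset.univ.filter fun o : Fin (p + 1) → Bool => OrientedHallSix s d t o) with hB
  have hmap : ∀ ob ∈ A ×ˢ (Finset.univ : Finset Bool),
      (fun ob : (Fin p → Bool) × Bool => (Fin.snoc ob.1 ob.2 : Fin (p + 1) → Bool)) ob ∈ B := by
    rintro ⟨o, b⟩ hob
    have ho : o ∈ A := (Finset.mem_product.1 hob).1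
    have hw := (Finset.mem_filter.1 ho).2
    exact Finset.mem_filter.2 ⟨Finset.mem_univ _, orientedHallSix_of_demote s d t o b hw⟩
  have hcard := Finset.card_le_card_of_injOn _ hmap ((snoc_orient_injective p).injOn)
  have hprod : (A ×ˢ (Finset.univ : Finset Bool)).card = A.card * 2 := by
    rw [Finset.card_product]; simp
  rw [hprod] at hcard
  omega

/-- The residual hypothesis: HALF-ORIENT for the mixed designs whose last-pair demotion is not a mixed design. -/
def HalfOrientRigidStep : Prop :=
  ∀ {p q : ℕ} (s d : Fin (p + 1) → ℕ) (t : Fin q → ℕ), IsMixedDesign s d t →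
    ¬ IsMixedDesign (fun i : Fin p => s i.castSucc) (fun i => d i.castSucc) (demoteT s d t) →
    2 ^ (p + 1) ≤ 2 * workingOrientations s d t

/-- Base case: a system without pairs has a working orientation (the empty one). -/
theorem workingOrientations_pos_zero {q : ℕ} (s d : Fin 0 → ℕ) (t : Fin q → ℕ) (hD : IsMixedDesign s d t) :
    1 ≤ workingOrientations s d t := by
  classical
  obtain ⟨ε, hle, hinj⟩ := zeroPair_hallSix s d t hD
  have hw : OrientedHallSix s d t (fun _ => true) := ⟨ε, fun _ k => k.elim0, hle, hinj⟩
  unfold workingOrientations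
  exact Finset.card_pos.2 ⟨_, Finset.mem_filter.2 ⟨Finset.mem_univ _, hw⟩⟩

/-- **Reduction of HALF-ORIENT to last-rigid systems** (induction on the number of pairs via the demotion lemma). -/
theorem halfOrientConjecture_of_rigidStep (hstep : HalfOrientRigidStep) : HalfOrientConjecture := by
  intro p
  induction p with
  | zero =>
    intro q s d t hD
    have := workingOrientations_pos_zero s d t hD
    simpa using by omega
  | succ p ih =>
    intro q s d t hD
    by_cases hdem : IsMixedDesign (fun i : Fin p => s i.castSucc) (fun i => d i.castSucc) (demoteT s d t)
    · have h1 := ih _ _ _ hdem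
      have h2 := two_mul_workingOrientations_demote_le s d t
      calc 2 ^ (p + 1) = 2 * 2 ^ p := by ring
        _ ≤ 2 * (2 * workingOrientations (fun i : Fin p => s i.castSucc) (fun i => d i.castSucc)
              (demoteT s d t)) := by omega
        _ ≤ 2 * workingOrientations s d t := by omega
    · exact hstep s d t hD hdem

end Summit.MatrixMultiplication.MatrixMultiplication.Theorems
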